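import Summits.BirchSwinnertonDyer.BirchSwinnertonDyer.Theorems.AdditiveBranchIMCTwistAtTwoAtkinLehnerSign
import Summits.BirchSwinnertonDyer.BirchSwinnertonDyer.Theorems.AdditiveBranchIMCTwistConductorAnyTwo
import Summits.BirchSwinnertonDyer.BirchSwinnertonDyer.Theorems.ManinLocalTwoThreeUnramifiedTwistReduction
import Literature.NumberTheory.EllipticCurves.BarriosEtAl2025.QuadraticTwistAtTwoConductorProofs
import Literature.NumberTheory.EllipticCurves.LFunctionSmulProofs
import Literature.NumberTheory.DiophantineGeometry.ConductorRingOfIntegersProofs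
import HarnessLib

/-!
# The Atkin–Lehner sign at a TWIST-TYPE ADDITIVE `2` is invariant under odd quadratic twists: `λ₂(f_{E^{(D)}}) = λ₂(f_E)`
# for `D ≡ 1 (mod 4)` (crux 19357 `GordTwoRankZeroOffCaseOne`, line `three_field_road`, brick «additive `2` on E3′ rows» of
# LeadReport26 §4 item 2; LEAD cruxlead-19357 g18, `--supports` 19357, helper only)

Theorems only (no definition, no named fact, no `sorry`). The E3′ root-number engines (`TwistRootNumberTwisted.rootNumber_quadraticTwist_eq_of_potMult_*`)
carry the binder «`E` not additive at `2`» (`h2`) because `λ₂` is read through the local root number, which the tree has only at a semistable `2`.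
At a twist-type additive `2` — `E` additive at `2` and `W₁ := E^{(t)}` NOT additive at `2` for some `t ∈ {−1, 2, −2}` (the dyadic clause of the
sub-row predicates `TwistRow` / `TwistedWanRowR0`) — the sign is read on the modular side instead: `E ≅ W₁^{(t)}` (`E^{(t²)} ≅ E`), `f₂(E) = 4, 6, 6`
for `t = −1, 2, −2` (Barrios et al. 2025 Thm. 5.1 at a semistable `2`, the tree's `conductorExponent_quadraticTwist_two_of_le_one_holds`), the odd
parts of `N_{W₁}` and `N_E` agree, so LEAD g17's absolute law (p814752, `atkinLehnerEigenvalueAt_two_eq_*_of_quadraticTwist_*`, Atkin–Li 1978 §3)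
gives **`λ₂(f_E) = χ_t(−1)`**; and `E^{(D)}` for `D ≡ 1 (mod 4)` is of the same shape with the same `t` (`f₂` is not moved by a twist
`≡ 1 (mod 4)`), so **`λ₂(f_{E^{(D)}}) = λ₂(f_E)`** — the factor at `2` of the Kronecker engine is `1` at an additive twist-type `2`.

* `hasReductionAt_two_quadraticTwist_iff_of_emod_four_eq_one` — reduction types at `2` agree along a twist `≡ 1 (mod 4)` (any type);
* `atkinLehnerEigenvalueAt_two_eq_of_twistType_two` — `λ₂(f_E) = χ_t(−1)` at a twist-type additive `2`;
* `atkinLehnerEigenvalueAt_two_quadraticTwist_eq_of_twistType_two` — `λ₂(f_{E^{(D)}}) = λ₂(f_E)`, `D ≡ 1 (mod 4)`.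

References: [AtkinLi1978] §3; [AtkinLehner1970] §6; [Rohrlich1993Compositio] Prop. 2 (iii); [BarriosEtAl2025] Thm. 5.1; [SilvermanAEC2009] X.5 Cor. 5.4.
presearch: n/a (tree assembly of p814752 + Barrios Thm 5.1). BSD is proved for no curve by any of this.
-/

set_option linter.dupNamespace false
set_option autoImplicit false

noncomputable section

open scoped MatrixGroups Classical

open CongruenceSubgroup Literature.NumberTheory.EllipticCurves Literature.NumberTheory.EllipticCurves.ModularForms
  IsDedekindDomain IsDedekindDomain.HeightOneSpectrum NumberField Rat.HeightOneSpectrum WeierstrassCurve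
  Summit.BirchSwinnertonDyer.BirchSwinnertonDyer.Theorems

namespace Summit.BirchSwinnertonDyer.BirchSwinnertonDyer.Theorems.TwistRootNumberTwisted

variable (W : WeierstrassCurve ℚ) [W.IsElliptic]

/-! ### §1 Reduction types at `2` along a twist `≡ 1 (mod 4)` -/

/-- **A twist by `D ≡ 1 (mod 4)` does not change the reduction type at `2`** (good / multiplicative / additive): `f₂(E^{(D)}) = f₂(E)`
(`TwistRootNumberAnyTwo.conductorExponent_quadraticTwist_eq_of_emod_four_eq_one`) and the type is read off `f₂ = 0`, `= 1`, `≥ 2`.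
[cite: SilvermanATAEC1994, IV.9.4 and IV.10.2] -/
theorem hasReductionAt_two_quadraticTwist_iff_of_emod_four_eq_one {D : ℤ} (hD4 : D % 4 = 1) :
    (haveI := W.isElliptic_quadraticTwist (show ((D : ℤ) : ℚ) ≠ 0 by exact_mod_cast (show D ≠ 0 by rintro rfl; norm_num at hD4));
      ((W.quadraticTwist (D : ℚ)).HasGoodReductionAt ((primesEquiv (R := ℤ)).symm ⟨2, Nat.prime_two⟩) ↔
          W.HasGoodReductionAt ((primesEquiv (R := ℤ)).symm ⟨2, Nat.prime_two⟩)) ∧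
      ((W.quadraticTwist (D : ℚ)).HasMultiplicativeReductionAt ((primesEquiv (R := ℤ)).symm ⟨2, Nat.prime_two⟩) ↔
          W.HasMultiplicativeReductionAt ((primesEquiv (R := ℤ)).symm ⟨2, Nat.prime_two⟩)) ∧
      ((W.quadraticTwist (D : ℚ)).HasAdditiveReductionAt ((primesEquiv (R := ℤ)).symm ⟨2, Nat.prime_two⟩) ↔
          W.HasAdditiveReductionAt ((primesEquiv (R := ℤ)).symm ⟨2, Nat.prime_two⟩))) := by
  have hD0 : D ≠ 0 := by rintro rfl; norm_num at hD4
  haveI := W.isElliptic_quadraticTwist (show ((D : ℤ) : ℚ) ≠ 0 by exact_mod_cast hD0)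
  set v : HeightOneSpectrum ℤ := (primesEquiv (R := ℤ)).symm ⟨2, Nat.prime_two⟩ with hv
  have hf : (W.quadraticTwist (D : ℚ)).conductorExponent v = W.conductorExponent v :=
    TwistRootNumberAnyTwo.conductorExponent_quadraticTwist_eq_of_emod_four_eq_one W ⟨2, Nat.prime_two⟩ rfl hD4
  refine ⟨?_, ?_, ?_⟩
  · rw [← conductorExponent_eq_zero_iff_holds v W, ← conductorExponent_eq_zero_iff_holds v (W.quadraticTwist (D : ℚ)), hf]
  · rw [← conductorExponent_eq_one_iff_holds v W, ← conductorExponent_eq_one_iff_holds v (W.quadraticTwist (D : ℚ)), hf]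
  · rw [← two_le_conductorExponent_iff_holds v W, ← two_le_conductorExponent_iff_holds v (W.quadraticTwist (D : ℚ)), hf]

/-! ### §2 `λ₂(f_E) = χ_t(−1)` at a twist-type additive `2` -/

/-- `f ≠ 0` for the newform of an elliptic curve. [folklore] -/
private theorem ne_zero_of_isNewformOf' {N : ℕ} [NeZero N] {X : WeierstrassCurve ℚ} {f : CuspForm (Gamma0 N) 2}
    (hf : IsNewformOf X f) : f ≠ 0 := fun h0 ↦ hf.1.coe_ne_zero (by rw [h0]; rfl)

/-- **`λ₂(f_E) = χ_t(−1)` AT A TWIST-TYPE ADDITIVE `2`.** Let `E/ℚ` be additive at `2` with `W₁ := E^{(t)}` NOT additive at `2` for some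
`t ∈ {−1, 2, −2}`, and let `f` be the newform of `E` (level `N_E`). Then `λ₂(f) = −1, +1, −1` for `t = −1, 2, −2`. Proof: `E ≅ W₁^{(t)}`
(`E^{(t²)} ≅ E`, Silverman X.5.4), `f₂(E) = 4` resp. `6` (Barrios et al. Thm. 5.1 at the semistable `2` of `W₁`), the odd parts of `N_{W₁}` and
`N_E` agree (`t` is a unit at every odd prime), so `N_{W₁} ∣ 4M` resp. `8M` and `N_E = 16M` resp. `64M` with `M` the odd part of `N_E`, and
LEAD g17's absolute law `atkinLehnerEigenvalueAt_two_eq_*_of_quadraticTwist_*` (Atkin–Li 1978 §3: `w_{m²}` acts on `f_{W₁} ⊗ χ_t` by `χ_t(−1)`)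
applies. [cite: AtkinLi1978, §3] [cite: BarriosEtAl2025, Thm. 5.1] [cite: SilvermanAEC2009, X.5 Cor. 5.4 and Ex. 10.16] -/
theorem atkinLehnerEigenvalueAt_two_eq_of_twistType_two (hmod : exists_isNewformOf)
    {t : ℤ} (ht : t = -1 ∨ t = 2 ∨ t = -2)
    (hadd : W.HasAdditiveReductionAt ((primesEquiv (R := ℤ)).symm ⟨2, Nat.prime_two⟩))
    (hnt : ¬ (W.quadraticTwist (t : ℚ)).HasAdditiveReductionAt ((primesEquiv (R := ℤ)).symm ⟨2, Nat.prime_two⟩))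
    {N : ℕ} [NeZero N] {f : CuspForm (Gamma0 N) 2} (hf : IsNewformOf W f) (hN : N = W.conductorNorm ℤ) :
    atkinLehnerEigenvalueAt f 2 = if t = 2 then 1 else -1 := by
  -- §0 notation
  have ht0 : t ≠ 0 := by rcases ht with rfl | rfl | rfl <;> norm_num
  have htQ : (t : ℚ) ≠ 0 := by exact_mod_cast ht0
  have htodd : ∀ q : ℕ, q.Prime → q ≠ 2 → ¬ (q : ℤ) ∣ t := by
    intro q hq hq2 h
    have h' : (q : ℤ) ∣ 2 := by
      rcases ht with rfl | rfl | rfl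
      · exact (dvd_neg.mp h).trans (one_dvd _)
      · exact h
      · exact dvd_neg.mp h
    have h2 : q ∣ 2 := by exact_mod_cast h'
    exact hq2 ((Nat.prime_dvd_prime_iff_eq hq Nat.prime_two).mp h2)
  set P2 : Nat.Primes := ⟨2, Nat.prime_two⟩ with hP2
  set v : HeightOneSpectrum ℤ := (primesEquiv (R := ℤ)).symm P2 with hv
  have hv2 : natGenerator v = 2 := by rw [hv, Rat.natGenerator_primesEquiv_symm]
  set W₁ := W.quadraticTwist (t : ℚ) with hW₁
  haveI : W₁.IsElliptic := W.isElliptic_quadraticTwist htQ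
  -- §1 `E ≅ W₁^{(t)}`
  obtain ⟨C, hC⟩ := W.exists_variableChange_smul_eq_quadraticTwist_sq (θ := (t : ℚ)) htQ
  have hE : W₁.quadraticTwist (t : ℚ) = C • W := by rw [hW₁, quadraticTwist_quadraticTwist, hC, sq]
  haveI : (W₁.quadraticTwist (t : ℚ)).IsElliptic := by rw [hE]; infer_instance
  have hfE : IsNewformOf (W₁.quadraticTwist (t : ℚ)) f := by
    rw [hE]; exact ⟨hf.1, fun n ↦ by rw [WeierstrassCurve.LFunction_smul W C]; exact hf.2 n⟩
  -- §2 conductor exponents at `2`: `f₂(W₁) ≤ 1`, `f₂(E) = 4` or `6`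
  have hf₁ : W₁.conductorExponent v ≤ 1 := by
    by_contra h
    exact hnt ((two_le_conductorExponent_iff_holds v W₁).mp (by omega))
  have key := BarriosEtAl2025.conductorExponent_quadraticTwist_two_of_le_one_holds W₁ v hv2 hf₁ t
  have hfE_eq : W.conductorExponent v = (W₁.quadraticTwist (t : ℚ)).conductorExponent v := by
    rw [hE, conductorExponent_smul' v W C]
  -- §3 levels: `M` = the odd part of `N_E`; `N_{W₁} = 2^{f₂(W₁)} M`, `N_E = 2^{f₂(E)} M`
  set NE := W.conductorNorm ℤ with hNE
  set N₁ := W₁.conductorNorm ℤ with hN₁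
  have hNE0 : NE ≠ 0 := (W.conductorNorm_pos_holds).ne'
  have hN₁0 : N₁ ≠ 0 := (W₁.conductorNorm_pos_holds).ne'
  haveI : NeZero (W₁.conductorNorm ℤ) := ⟨hN₁0⟩
  set M : ℕ := ordCompl[2] NE with hM
  have hM0 : M ≠ 0 := (Nat.ordCompl_pos 2 hNE0).ne'
  haveI : NeZero M := ⟨hM0⟩
  have h2M : ¬ 2 ∣ M := Nat.not_dvd_ordCompl Nat.prime_two hNE0
  have hoddparts : ordCompl[2] N₁ = M := by
    refine Nat.eq_of_factorization_eq (Nat.ordCompl_pos 2 hN₁0).ne' hM0 fun q ↦ ?_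
    rw [hM, Nat.factorization_ordCompl, Nat.factorization_ordCompl]
    by_cases hq2 : q = 2
    · subst hq2; simp only [Finsupp.erase_same]
    · rw [Finsupp.erase_ne hq2, Finsupp.erase_ne hq2]
      by_cases hq : q.Prime
      · rw [hN₁, hW₁]
        exact ManinLocalTwoThree.factorization_conductorNorm_quadraticTwist_eq_of_not_dvd_odd W hq hq2 (htodd q hq hq2)
      · rw [Nat.factorization_eq_zero_of_not_prime _ hq, Nat.factorization_eq_zero_of_not_prime _ hq]
  have hfacE : NE.factorization 2 = W.conductorExponent v := by
    rw [show NE.factorization 2 = NE.factorization P2 from rfl, hNE, factorization_conductorNorm_primesEquiv_symm W P2]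
  have hfac₁ : N₁.factorization 2 = W₁.conductorExponent v := by
    rw [show N₁.factorization 2 = N₁.factorization P2 from rfl, hN₁, factorization_conductorNorm_primesEquiv_symm W₁ P2]
  have hNE_eq : NE = 2 ^ (W.conductorExponent v) * M := by
    rw [← hfacE, hM]; exact (Nat.ordProj_mul_ordCompl_eq_self NE 2).symm
  have hN₁_eq : N₁ = 2 ^ (W₁.conductorExponent v) * M := by
    rw [← hfac₁, ← hoddparts]; exact (Nat.ordProj_mul_ordCompl_eq_self N₁ 2).symm
  have hN₁_dvd : N₁ ∣ M * 2 := by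
    rw [hN₁_eq, mul_comm]
    exact mul_dvd_mul_left M (Nat.pow_dvd_pow_iff_le_right one_lt_two |>.mpr (by simpa using hf₁) |>.trans (by rw [pow_one]))
  -- the newform of `W₁`
  obtain ⟨f₁, hf₁N⟩ := hmod W₁
  -- §4 additivity of `W₁^{(t)} = C • E` at every place of `𝓞 ℚ` above `2`
  have haddO : ∀ w : HeightOneSpectrum (𝓞 ℚ), (primesEquiv w : ℕ) = 2 → (W₁.quadraticTwist (t : ℚ)).HasAdditiveReductionAt w := by
    intro w hw
    have hww : (primesEquiv w : Nat.Primes) = primesEquiv v := by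
      rw [hv, Equiv.apply_symm_apply]; exact Subtype.ext hw
    refine (two_le_conductorExponent_iff_holds w _).mp ?_
    rw [conductorExponent_eq_of_primesEquiv_eq w v _ hww, ← hfE_eq]
    exact (two_le_conductorExponent_iff_holds v W).mpr hadd
  -- §5 the three cases
  subst hN
  rcases ht with rfl | rfl | rfl
  · -- `t = −1`: `f₂(E) = 4`, `N_E = 16 M`, `N_{W₁} ∣ 4M`
    have h4 : W.conductorExponent v = 4 := by rw [hfE_eq]; exact key.1 (by decide)
    have hNE' : W.conductorNorm ℤ = M * 4 ^ 2 := by rw [← hNE, hNE_eq, h4]; ring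
    have hN₁' : W₁.conductorNorm ℤ ∣ M * 4 := hN₁_dvd.trans (mul_dvd_mul_left M (by norm_num))
    have hcast : ((-1 : ℤ) : ℚ) = -1 := by norm_num
    have haddO' : ∀ w : HeightOneSpectrum (𝓞 ℚ), (primesEquiv w : ℕ) = 2 → (W₁.quadraticTwist (-1)).HasAdditiveReductionAt w := by
      rw [← hcast]; exact haddO
    have hfE' : IsNewformOf (W₁.quadraticTwist (-1)) f := by rw [← hcast]; exact hfE
    rw [if_neg (by norm_num)]
    exact atkinLehnerEigenvalueAt_two_eq_neg_one_of_quadraticTwist_neg_one W₁ h2M hN₁' hNE' haddO' hf₁N hfE'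
  · -- `t = 2`: `f₂(E) = 6`, `N_E = 64 M`, `N_{W₁} ∣ 8M`
    have h6 : W.conductorExponent v = 6 := by rw [hfE_eq]; exact key.2 (by decide)
    have hNE' : W.conductorNorm ℤ = M * 8 ^ 2 := by rw [← hNE, hNE_eq, h6]; ring
    have hN₁' : W₁.conductorNorm ℤ ∣ M * 8 := hN₁_dvd.trans (mul_dvd_mul_left M (by norm_num))
    have hcast : ((2 : ℤ) : ℚ) = 2 := by norm_num
    have haddO' : ∀ w : HeightOneSpectrum (𝓞 ℚ), (primesEquiv w : ℕ) = 2 → (W₁.quadraticTwist 2).HasAdditiveReductionAt w := by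
      rw [← hcast]; exact haddO
    have hfE' : IsNewformOf (W₁.quadraticTwist 2) f := by rw [← hcast]; exact hfE
    rw [if_pos rfl]
    exact atkinLehnerEigenvalueAt_two_eq_one_of_quadraticTwist_two W₁ h2M hN₁' hNE' haddO' hf₁N hfE'
  · -- `t = −2`: `f₂(E) = 6`, `N_E = 64 M`, `N_{W₁} ∣ 8M`
    have h6 : W.conductorExponent v = 6 := by rw [hfE_eq]; exact key.2 (by decide)
    have hNE' : W.conductorNorm ℤ = M * 8 ^ 2 := by rw [← hNE, hNE_eq, h6]; ring
    have hN₁' : W₁.conductorNorm ℤ ∣ M * 8 := hN₁_dvd.trans (mul_dvd_mul_left M (by norm_num))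
    have hcast : ((-2 : ℤ) : ℚ) = -2 := by norm_num
    have haddO' : ∀ w : HeightOneSpectrum (𝓞 ℚ), (primesEquiv w : ℕ) = 2 → (W₁.quadraticTwist (-2)).HasAdditiveReductionAt w := by
      rw [← hcast]; exact haddO
    have hfE' : IsNewformOf (W₁.quadraticTwist (-2)) f := by rw [← hcast]; exact hfE
    rw [if_neg (by norm_num)]
    exact atkinLehnerEigenvalueAt_two_eq_neg_one_of_quadraticTwist_neg_two W₁ h2M hN₁' hNE' haddO' hf₁N hfE'

/-! ### §3 Invariance under a twist `≡ 1 (mod 4)` -/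

/-- **`λ₂(f_{E^{(D)}}) = λ₂(f_E)` for `D ≡ 1 (mod 4)` AT A TWIST-TYPE ADDITIVE `2`**: `E^{(D)}` is again additive at `2` with
`(E^{(D)})^{(t)} = (E^{(t)})^{(D)}` not additive at `2` (`hasReductionAt_two_quadraticTwist_iff_of_emod_four_eq_one`), so both signs are
`χ_t(−1)` (`atkinLehnerEigenvalueAt_two_eq_of_twistType_two`). This is the factor at `2` of the E3′ root-number engine at an additive
twist-type `2` (LeadReport26 §4 item 2). [cite: AtkinLi1978, §3] [cite: BarriosEtAl2025, Thm. 5.1] [cite: SilvermanAEC2009, X.5 Cor. 5.4] -/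
theorem atkinLehnerEigenvalueAt_two_quadraticTwist_eq_of_twistType_two (hmod : exists_isNewformOf)
    {t : ℤ} (ht : t = -1 ∨ t = 2 ∨ t = -2)
    (hadd : W.HasAdditiveReductionAt ((primesEquiv (R := ℤ)).symm ⟨2, Nat.prime_two⟩))
    (hnt : ¬ (W.quadraticTwist (t : ℚ)).HasAdditiveReductionAt ((primesEquiv (R := ℤ)).symm ⟨2, Nat.prime_two⟩))
    {D : ℤ} (hD4 : D % 4 = 1)
    {N : ℕ} [NeZero N] {f : CuspForm (Gamma0 N) 2} (hf : IsNewformOf W f) (hN : N = W.conductorNorm ℤ)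
    {N' : ℕ} [NeZero N'] {f' : CuspForm (Gamma0 N') 2} (hf' : IsNewformOf (W.quadraticTwist (D : ℚ)) f')
    (hN' : (haveI := W.isElliptic_quadraticTwist (show ((D : ℤ) : ℚ) ≠ 0 by exact_mod_cast (show D ≠ 0 by rintro rfl; norm_num at hD4));
      N' = (W.quadraticTwist (D : ℚ)).conductorNorm ℤ)) :
    atkinLehnerEigenvalueAt f' 2 = atkinLehnerEigenvalueAt f 2 := by
  have hD0 : D ≠ 0 := by rintro rfl; norm_num at hD4
  have hDQ : ((D : ℤ) : ℚ) ≠ 0 := by exact_mod_cast hD0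
  have ht0 : t ≠ 0 := by rcases ht with rfl | rfl | rfl <;> norm_num
  have htQ : (t : ℚ) ≠ 0 := by exact_mod_cast ht0
  haveI := W.isElliptic_quadraticTwist hDQ
  haveI := W.isElliptic_quadraticTwist htQ
  -- `E^{(D)}` is additive at `2`
  have hadd' : (W.quadraticTwist (D : ℚ)).HasAdditiveReductionAt ((primesEquiv (R := ℤ)).symm ⟨2, Nat.prime_two⟩) :=
    ((hasReductionAt_two_quadraticTwist_iff_of_emod_four_eq_one W hD4).2.2).mpr hadd
  -- `(E^{(D)})^{(t)} = (E^{(t)})^{(D)}` is not additive at `2`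
  have heq : (W.quadraticTwist (D : ℚ)).quadraticTwist (t : ℚ) = (W.quadraticTwist (t : ℚ)).quadraticTwist (D : ℚ) := by
    rw [quadraticTwist_quadraticTwist, quadraticTwist_quadraticTwist, mul_comm]
  have hnt' : ¬ ((W.quadraticTwist (D : ℚ)).quadraticTwist (t : ℚ)).HasAdditiveReductionAt
      ((primesEquiv (R := ℤ)).symm ⟨2, Nat.prime_two⟩) := by
    rw [heq]
    exact fun h ↦ hnt (((hasReductionAt_two_quadraticTwist_iff_of_emod_four_eq_one (W.quadraticTwist (t : ℚ)) hD4).2.2).mp h)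
  rw [atkinLehnerEigenvalueAt_two_eq_of_twistType_two (W.quadraticTwist (D : ℚ)) hmod ht hadd' hnt' hf' hN',
    atkinLehnerEigenvalueAt_two_eq_of_twistType_two W hmod ht hadd hnt hf hN]

end Summit.BirchSwinnertonDyer.BirchSwinnertonDyer.Theorems.TwistRootNumberTwisted

end
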